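import Summits.QuantumFields.YangMills.Theorems.TwistedTraceScaling.Negative.FlatProximityExponent
import Summits.QuantumFields.YangMills.Theorems.LuscherReductionOneSiteLevelsKacChart
import Summits.QuantumFields.YangMills.Theorems.LuscherReductionOneSiteLevelsActionLipschitz
import HarnessLib

/-!
# Kit for negative lemma R9 of crux `TwistedTraceScaling` (stmt-QuantumFields-20203): the centre-twisted two-link configuration, constant
# configurations, gauge covariance of lines, per-link Lipschitz bounds, and two quaternion lemmas (even-power rigidity, almost-commutation)

Standing disprover `ym-cdisprove-20203-1` (gen 9).  Support module for `Negative/ConstProximityCentreTwist.lean`: the REPAIRED fixed-lattice brick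
«`S(U) ≤ σ` ⇒ modulo gauge every link is within `C(L)·S^α` of a CONSTANT configuration» (lane B's LOWER-BLUEPRINT §5; the repair line of
`Negative/FlatProximityQuartic.lean`) is STILL FALSE at every EVEN `L` for every `α > 1/4` — the centre-twisted constants (the tree's 't Hooft twist
`twist 2 negOne` of a constant configuration) are a second family of quartic valleys, `≍ 1/L` away from the gauge orbit of the constants when `L` is
even.  Contents: §1 the witness `twist 2 z (twoLinkCfg a b)` and the constant configurations `fun e => c e.2` — line holonomies (`a^n`, `b^n`, and
EXACTLY `z` once around direction 2), mixed plaquettes trivial, gauge covariance of open lines; §2 per-link Lipschitz bounds for plaquettes and powers,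
conjugation swap; §3 **even-power rigidity** (`X^{2m}` within `ε` of `−1` ⇒ `m²|Im X|² ≥ 1 − ε/2`, via `|Im X^k| ≤ k|Im X|`) and **almost-commutation**
(`‖1 − [X,N]‖_F ≤ η ⇒ |Im X × Im N|² ≤ η²/8`).
## WHAT THIS IS NOT
Fixed-lattice / quaternion algebra on the Negative/ lane (`--supports stmt-QuantumFields-20203`); nothing about the crux, its stubs, the continuum or
the Clay gap.  HONEST FRAMING: femto rung R2b1, stub support of a child of a CONDITIONAL reduction route.  Sorry-free, no new definition; axioms ⊆
{propext, Classical.choice, Quot.sound}.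
-/

set_option autoImplicit false

noncomputable section

open scoped Matrix Quaternion BigOperators
open Literature.MathematicalPhysics.QuantumFieldTheory hiding SU2
open Literature.MathematicalPhysics.QuantumLattice
open Summit.QuantumFields.YangMills.Theorems.FemtoTransferGap
open Summit.QuantumFields.YangMills.Theorems.FemtoTransferGap.PhysL2 (twoLinkCfg plaquetteHolonomy_twoLinkCfg scalarPart_comm_eq)
open Summit.QuantumFields.YangMills.Theorems.FemtoTransferGap.TwoLattice.Chart (frobNorm_sub_sq_eq)
open Summit.QuantumFields.YangMills.Theorems.TwistedTraceScaling.Negative.R8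

namespace Summit.QuantumFields.YangMills.Theorems.TwistedTraceScaling.Negative.R9

/-! ## §1 Lattice kit: constant configurations, the twisted two-link witness, gauge covariance of lines -/

section Lattice

variable {L : ℕ}

/-- Line holonomies of a constant configuration are powers. [folklore] -/
theorem lineHolonomy_const (c : Fin 3 → SU2) (k : Fin 3) : ∀ (n : ℕ) (y : Site 3 L), lineHolonomy (fun e : Edge 3 L => c e.2) k n y = c k ^ n
  | 0, y => by simp [lineHolonomy]
  | n + 1, y => by rw [lineHolonomy, lineHolonomy_const c k n, pow_succ']

/-- Plaquettes of a constant configuration are commutators. [folklore] -/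
theorem plaquetteHolonomy_const (c : Fin 3 → SU2) (x : Site 3 L) (i j : Fin 3) :
    plaquetteHolonomy (fun e : Edge 3 L => c e.2) x i j = c i * c j * (c i)⁻¹ * (c j)⁻¹ := rfl

/-- Direction-0 line holonomies of the twisted two-link configuration: `a^n`. [folklore] -/
theorem lineHolonomy_twist_twoLinkCfg_zero (z a b : SU2) : ∀ (n : ℕ) (y : Site 3 L), lineHolonomy (twist 2 z (twoLinkCfg (L := L) a b)) 0 n y = a ^ n
  | 0, y => by simp [lineHolonomy]
  | n + 1, y => by
    rw [lineHolonomy, lineHolonomy_twist_twoLinkCfg_zero z a b n, pow_succ']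
    simp [twist, twoLinkCfg]

/-- Direction-1 line holonomies of the twisted two-link configuration: `b^n`. [folklore] -/
theorem lineHolonomy_twist_twoLinkCfg_one (z a b : SU2) : ∀ (n : ℕ) (y : Site 3 L), lineHolonomy (twist 2 z (twoLinkCfg (L := L) a b)) 1 n y = b ^ n
  | 0, y => by simp [lineHolonomy]
  | n + 1, y => by
    rw [lineHolonomy, lineHolonomy_twist_twoLinkCfg_one z a b n, pow_succ']
    simp [twist, twoLinkCfg]

/-- A direction-2 line that does not cross the twisted slice `x₂ = 0` has trivial holonomy. [folklore] -/
theorem lineHolonomy_twist_twoLinkCfg_two_eq_one (z a b : SU2) : ∀ (n : ℕ) (y : Site 3 L), (∀ t : ℕ, t < n → y 2 + (t : ZMod L) ≠ 0) →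
    lineHolonomy (twist 2 z (twoLinkCfg (L := L) a b)) 2 n y = 1
  | 0, y, _ => by simp [lineHolonomy]
  | n + 1, y, h => by
    have h0 : y 2 ≠ 0 := by simpa using h 0 (Nat.succ_pos n)
    have h' : ∀ t : ℕ, t < n → (y.shift 2) 2 + (t : ZMod L) ≠ 0 := fun t ht => by
      have := h (t + 1) (by omega)
      simp only [Site.shift, Pi.add_apply, Pi.single_eq_same, Nat.cast_succ] at this ⊢
      rwa [add_assoc, add_comm (1 : ZMod L)]
    rw [lineHolonomy, lineHolonomy_twist_twoLinkCfg_two_eq_one z a b n (y.shift 2) h', mul_one]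
    simp [twist, twoLinkCfg, h0]

/-- **The direction-2 Polyakov line of the twisted configuration through the origin is EXACTLY the twist `z`** (it crosses the slice once).
[cite: tHooft1979] -/
theorem lineHolonomy_twist_twoLinkCfg_two [NeZero L] (z a b : SU2) : lineHolonomy (twist 2 z (twoLinkCfg (L := L) a b)) 2 L 0 = z := by
  obtain ⟨L', rfl⟩ : ∃ L', L = L' + 1 := Nat.exists_eq_succ_of_ne_zero (NeZero.ne L)
  have hne : ∀ t : ℕ, t < L' → ((0 : Site 3 (L' + 1)).shift 2) 2 + (t : ZMod (L' + 1)) ≠ 0 := fun t ht h => by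
    simp only [Site.shift, Pi.add_apply, Pi.zero_apply, Pi.single_eq_same, zero_add] at h
    have h1 : ((t + 1 : ℕ) : ZMod (L' + 1)) = 0 := by rw [Nat.cast_succ]; exact (add_comm _ _).trans h
    have h2 := congrArg ZMod.val h1
    rw [ZMod.val_natCast, ZMod.val_zero, Nat.mod_eq_of_lt (by omega)] at h2
    omega
  rw [lineHolonomy, lineHolonomy_twist_twoLinkCfg_two_eq_one z a b L' _ hne, mul_one]
  simp [twist, twoLinkCfg]

/-- **The mixed `(i,2)` plaquettes of the twisted two-link configuration are trivial** (central `z`; `i = 0, 1`). [cite: tHooft1979] -/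
theorem plaquetteHolonomy_twist_twoLinkCfg_two {z : SU2} (hz : z ∈ Subgroup.center SU2) (a b : SU2) (x : Site 3 L) {i : Fin 3} (hi : i ≠ 2) :
    plaquetteHolonomy (twist 2 z (twoLinkCfg (L := L) a b)) x i 2 = 1 := by
  rw [plaquetteHolonomy_twist_of_mem_center 2 hz _ x hi]
  fin_cases i
  · simp [plaquetteHolonomy, twoLinkCfg]
  · simp [plaquetteHolonomy, twoLinkCfg]
  · exact absurd rfl hi

/-- `y.shift k + n e_k = y + (n+1) e_k`. [folklore] -/
private theorem shift_add_single (y : Site 3 L) (k : Fin 3) (n : ℕ) :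
    y.shift k + Pi.single k (n : ZMod L) = y + Pi.single k ((n + 1 : ℕ) : ZMod L) := by
  rw [Site.shift, add_assoc, ← Pi.single_add, Nat.cast_succ, add_comm (1 : ZMod L)]

/-- **Open lines are gauge-transformed at their endpoints**: `P_k(n; y)(g·U) = g(y) P_k(n; y)(U) g(y + n e_k)⁻¹`. [folklore] -/
theorem lineHolonomy_gaugeTransform₃ (g : Site 3 L → SU2) (U : GaugeConfig 3 L SU2) (k : Fin 3) :
    ∀ (n : ℕ) (y : Site 3 L), lineHolonomy (gaugeTransform g U) k n y = g y * lineHolonomy U k n y * (g (y + Pi.single k (n : ZMod L)))⁻¹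
  | 0, y => by simp [lineHolonomy]
  | n + 1, y => by
    rw [lineHolonomy, lineHolonomy, lineHolonomy_gaugeTransform₃ g U k n (y.shift k), shift_add_single]
    simp only [gaugeTransform]
    group

/-- Full-period lines (Polyakov loops) are CONJUGATED by `g` at the base point. [folklore] -/
theorem lineHolonomy_gaugeTransform_period (g : Site 3 L → SU2) (U : GaugeConfig 3 L SU2) (k : Fin 3) (y : Site 3 L) :
    lineHolonomy (gaugeTransform g U) k L y = g y * lineHolonomy U k L y * (g y)⁻¹ := by
  rw [lineHolonomy_gaugeTransform₃, ZMod.natCast_self, Pi.single_zero, add_zero]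

end Lattice

/-! ## §2 Frobenius kit on `SU(2)` -/

section Frob

variable {L : ℕ}

/-- The triangle inequality in the form `‖A − C‖_F ≤ ‖A − B‖_F + ‖B − C‖_F`. [folklore] -/
theorem frobNorm_sub_le_of_mid (A B C : Matrix (Fin 2) (Fin 2) ℂ) : frobNorm (A - C) ≤ frobNorm (A - B) + frobNorm (B - C) := by
  have : A - C = (A - B) + (B - C) := by abel
  rw [this]; exact frobNorm_add_le _ _

/-- **Plaquettes are 4-Lipschitz in the links (per-link form)**: `‖P_U − P_V‖_F ≤ 4·max_e ‖U_e − V_e‖_F`. [folklore] -/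
theorem frobNorm_plaquetteHolonomy_sub_le_of_forall {U V : GaugeConfig 3 L SU2} {r : ℝ}
    (h : ∀ e, frobNorm ((U e : Matrix (Fin 2) (Fin 2) ℂ) - (V e : Matrix (Fin 2) (Fin 2) ℂ)) ≤ r) (x : Site 3 L) (i j : Fin 3) :
    frobNorm (((plaquetteHolonomy U x i j : SU2) : Matrix (Fin 2) (Fin 2) ℂ) - ((plaquetteHolonomy V x i j : SU2) : Matrix (Fin 2) (Fin 2) ℂ)) ≤ 4 * r := by
  have hu : ∀ W : SU2, (W : Matrix (Fin 2) (Fin 2) ℂ) ∈ Matrix.unitaryGroup (Fin 2) ℂ := fun W => su2_mem_unitaryGroup W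
  have h1 := h (x, i)
  have h2 := h (x.shift i, j)
  have h3 : frobNorm ((((U (x.shift j, i))⁻¹ : SU2) : Matrix (Fin 2) (Fin 2) ℂ) - (((V (x.shift j, i))⁻¹ : SU2) : Matrix (Fin 2) (Fin 2) ℂ)) ≤ r := by
    rw [frobNorm_inv_sub_inv]; exact h _
  have h4 : frobNorm ((((U (x, j))⁻¹ : SU2) : Matrix (Fin 2) (Fin 2) ℂ) - (((V (x, j))⁻¹ : SU2) : Matrix (Fin 2) (Fin 2) ℂ)) ≤ r := by
    rw [frobNorm_inv_sub_inv]; exact h _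
  have hu2 : (V (x, i) : Matrix (Fin 2) (Fin 2) ℂ) * (V (x.shift i, j) : Matrix (Fin 2) (Fin 2) ℂ) ∈ Matrix.unitaryGroup (Fin 2) ℂ := by
    rw [← Submonoid.coe_mul]; exact hu _
  have hu3 : (V (x, i) : Matrix (Fin 2) (Fin 2) ℂ) * (V (x.shift i, j) : Matrix (Fin 2) (Fin 2) ℂ) *
      (((V (x.shift j, i))⁻¹ : SU2) : Matrix (Fin 2) (Fin 2) ℂ) ∈ Matrix.unitaryGroup (Fin 2) ℂ := by
    rw [← Submonoid.coe_mul, ← Submonoid.coe_mul]; exact hu _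
  have s1 := frobNorm_mul_sub_mul_le (a := (U (x, i) : Matrix (Fin 2) (Fin 2) ℂ) * (U (x.shift i, j) : Matrix (Fin 2) (Fin 2) ℂ) *
      (((U (x.shift j, i))⁻¹ : SU2) : Matrix (Fin 2) (Fin 2) ℂ)) (p := (((U (x, j))⁻¹ : SU2) : Matrix (Fin 2) (Fin 2) ℂ))
    (q := (((V (x, j))⁻¹ : SU2) : Matrix (Fin 2) (Fin 2) ℂ)) hu3 (hu _)
  have s2 := frobNorm_mul_sub_mul_le (a := (U (x, i) : Matrix (Fin 2) (Fin 2) ℂ) * (U (x.shift i, j) : Matrix (Fin 2) (Fin 2) ℂ))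
    (p := (((U (x.shift j, i))⁻¹ : SU2) : Matrix (Fin 2) (Fin 2) ℂ)) (q := (((V (x.shift j, i))⁻¹ : SU2) : Matrix (Fin 2) (Fin 2) ℂ)) hu2 (hu _)
  have s3 := frobNorm_mul_sub_mul_le (a := (U (x, i) : Matrix (Fin 2) (Fin 2) ℂ)) (p := (U (x.shift i, j) : Matrix (Fin 2) (Fin 2) ℂ))
    (q := (V (x.shift i, j) : Matrix (Fin 2) (Fin 2) ℂ)) (hu (V (x, i))) (hu _)
  simp only [plaquetteHolonomy, Submonoid.coe_mul]
  linarith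

/-- **Powers are `n`-Lipschitz**: `‖X^n − Y^n‖_F ≤ n‖X − Y‖_F` on `SU(2)`. [folklore] -/
theorem frobNorm_pow_sub_pow_le' (X Y : SU2) : ∀ n : ℕ, frobNorm (((X ^ n : SU2) : Matrix (Fin 2) (Fin 2) ℂ) - ((Y ^ n : SU2) : Matrix (Fin 2) (Fin 2) ℂ)) ≤
    n * frobNorm ((X : Matrix (Fin 2) (Fin 2) ℂ) - (Y : Matrix (Fin 2) (Fin 2) ℂ))
  | 0 => by simp [frobNorm_zero]
  | n + 1 => by
    rw [pow_succ', pow_succ', Submonoid.coe_mul, Submonoid.coe_mul, Nat.cast_succ]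
    have ih := frobNorm_pow_sub_pow_le' X Y n
    linarith [frobNorm_mul_sub_mul_le (a := (X : Matrix (Fin 2) (Fin 2) ℂ)) (q := ((Y ^ n : SU2) : Matrix (Fin 2) (Fin 2) ℂ))
      (su2_mem_unitaryGroup Y) (su2_mem_unitaryGroup (X ^ n))]

/-- Conjugation swap: `‖h A h⁻¹ − B‖_F = ‖A − h⁻¹ B h‖_F`. [folklore] -/
theorem frobNorm_conj_sub (h A B : SU2) : frobNorm (((h * A * h⁻¹ : SU2) : Matrix (Fin 2) (Fin 2) ℂ) - (B : Matrix (Fin 2) (Fin 2) ℂ)) =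
    frobNorm ((A : Matrix (Fin 2) (Fin 2) ℂ) - ((h⁻¹ * B * h : SU2) : Matrix (Fin 2) (Fin 2) ℂ)) := by
  have hid : ((h * A * h⁻¹ : SU2) : Matrix (Fin 2) (Fin 2) ℂ) - (B : Matrix (Fin 2) (Fin 2) ℂ) =
      (h : Matrix (Fin 2) (Fin 2) ℂ) * ((A : Matrix (Fin 2) (Fin 2) ℂ) - ((h⁻¹ * B * h : SU2) : Matrix (Fin 2) (Fin 2) ℂ)) * ((h⁻¹ : SU2) : Matrix (Fin 2) (Fin 2) ℂ) := by
    rw [Matrix.mul_sub, Matrix.sub_mul, ← Submonoid.coe_mul, ← Submonoid.coe_mul, ← Submonoid.coe_mul, ← Submonoid.coe_mul,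
      show h * (h⁻¹ * B * h) * h⁻¹ = B by group]
  rw [hid, frobNorm_mul_unitary _ (su2_mem_unitaryGroup _), frobNorm_unitary_mul (su2_mem_unitaryGroup _)]

end Frob

/-! ## §3 Quaternion kit: the centre element, even-power rigidity, almost-commutation -/

section Quat

/-- `su2Quat` is multiplicative (tree). [folklore] -/
private theorem quat_mul (U W : SU2) : su2Quat (U * W) = su2Quat U * su2Quat W := Balaban1983to89.T4HaarSU2Translate.su2Quat_mul U W

/-- `su2Quat 1 = 1` (tree). [folklore] -/
private theorem quat_one : su2Quat (1 : SU2) = 1 := Balaban1983to89.T4HaarSU2Translate.su2Quat_one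

/-- `−1` is invariant under conjugation. [folklore] -/
theorem conj_negOne (h : SU2) : h * negOne * h⁻¹ = negOne := by
  rw [← negOne_mul_comm h, mul_inv_cancel_right]

/-- The scalar and vector parts of `−1`. [folklore] -/
theorem parts_negOne : scalarPart negOne = -1 ∧ vecPart negOne 0 = 0 ∧ vecPart negOne 1 = 0 ∧ vecPart negOne 2 = 0 := by
  simp [scalarPart_eq]

/-- **Powers stay in the plane `span(1, Im X)`**: `Im(X^n) = t_n · Im X` with `|t_n| ≤ n`. [folklore] -/
theorem vec_pow_eq_smul (X : SU2) : ∀ n : ℕ, ∃ t : ℝ, |t| ≤ n ∧ (su2Quat (X ^ n)).imI = t * (su2Quat X).imI ∧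
    (su2Quat (X ^ n)).imJ = t * (su2Quat X).imJ ∧ (su2Quat (X ^ n)).imK = t * (su2Quat X).imK
  | 0 => ⟨0, by simp, by simp [quat_one], by simp [quat_one], by simp [quat_one]⟩
  | n + 1 => by
    obtain ⟨t, ht, hI, hJ, hK⟩ := vec_pow_eq_smul X n
    have hP : |(su2Quat (X ^ n)).re| ≤ 1 := abs_scalarPart_le (X ^ n)
    have hx : |(su2Quat X).re| ≤ 1 := abs_scalarPart_le X
    have eI : (su2Quat (X ^ n) * su2Quat X).imI = (su2Quat (X ^ n)).re * (su2Quat X).imI + (su2Quat (X ^ n)).imI * (su2Quat X).re +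
        (su2Quat (X ^ n)).imJ * (su2Quat X).imK - (su2Quat (X ^ n)).imK * (su2Quat X).imJ := by simp
    have eJ : (su2Quat (X ^ n) * su2Quat X).imJ = (su2Quat (X ^ n)).re * (su2Quat X).imJ - (su2Quat (X ^ n)).imI * (su2Quat X).imK +
        (su2Quat (X ^ n)).imJ * (su2Quat X).re + (su2Quat (X ^ n)).imK * (su2Quat X).imI := by simp
    have eK : (su2Quat (X ^ n) * su2Quat X).imK = (su2Quat (X ^ n)).re * (su2Quat X).imK + (su2Quat (X ^ n)).imI * (su2Quat X).imJ -
        (su2Quat (X ^ n)).imJ * (su2Quat X).imI + (su2Quat (X ^ n)).imK * (su2Quat X).re := by simp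
    refine ⟨(su2Quat (X ^ n)).re + t * (su2Quat X).re, ?_, ?_, ?_, ?_⟩
    · have h1 : |t * (su2Quat X).re| ≤ n * 1 := by rw [abs_mul]; exact mul_le_mul ht hx (abs_nonneg _) (Nat.cast_nonneg n)
      calc |(su2Quat (X ^ n)).re + t * (su2Quat X).re| ≤ |(su2Quat (X ^ n)).re| + |t * (su2Quat X).re| := abs_add_le _ _
        _ ≤ (n + 1 : ℕ) := by push_cast; linarith
    · rw [pow_succ, quat_mul, eI, hI, hJ, hK]; ring
    · rw [pow_succ, quat_mul, eJ, hI, hJ, hK]; ring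
    · rw [pow_succ, quat_mul, eK, hI, hJ, hK]; ring

/-- Hence `|Im(X^n)|² ≤ n²|Im X|²`. [folklore] -/
theorem sum_vecPart_pow_sq_le (X : SU2) (n : ℕ) : ∑ i, vecPart (X ^ n) i ^ 2 ≤ (n : ℝ) ^ 2 * ∑ i, vecPart X i ^ 2 := by
  obtain ⟨t, ht, hI, hJ, hK⟩ := vec_pow_eq_smul X n
  have ht2 : t ^ 2 ≤ (n : ℝ) ^ 2 := by rw [← sq_abs]; exact pow_le_pow_left₀ (abs_nonneg t) ht 2
  rw [Fin.sum_univ_three, Fin.sum_univ_three]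
  change (su2Quat (X ^ n)).imI ^ 2 + (su2Quat (X ^ n)).imJ ^ 2 + (su2Quat (X ^ n)).imK ^ 2 ≤
    (n : ℝ) ^ 2 * ((su2Quat X).imI ^ 2 + (su2Quat X).imJ ^ 2 + (su2Quat X).imK ^ 2)
  rw [hI, hJ, hK]
  calc (t * (su2Quat X).imI) ^ 2 + (t * (su2Quat X).imJ) ^ 2 + (t * (su2Quat X).imK) ^ 2
      = t ^ 2 * ((su2Quat X).imI ^ 2 + (su2Quat X).imJ ^ 2 + (su2Quat X).imK ^ 2) := by ring
    _ ≤ (n : ℝ) ^ 2 * ((su2Quat X).imI ^ 2 + (su2Quat X).imJ ^ 2 + (su2Quat X).imK ^ 2) := mul_le_mul_of_nonneg_right ht2 (by positivity)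

/-- The scalar part of a square: `Re(P²) = 2(Re P)² − 1`. [folklore] -/
theorem scalarPart_mul_self (P : SU2) : scalarPart (P * P) = 2 * scalarPart P ^ 2 - 1 := by
  have hn := normSq_su2Quat P
  rw [Quaternion.normSq_def'] at hn
  have e : (su2Quat P * su2Quat P).re = (su2Quat P).re * (su2Quat P).re - (su2Quat P).imI * (su2Quat P).imI -
      (su2Quat P).imJ * (su2Quat P).imJ - (su2Quat P).imK * (su2Quat P).imK := by simp
  change (su2Quat (P * P)).re = 2 * (su2Quat P).re ^ 2 - 1
  rw [quat_mul, e]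
  linear_combination (-1 : ℝ) * hn

/-- **Even-power rigidity.**  If `X^{2m}` is within Frobenius distance `ε` of the centre element `−1`, then `m²·|Im X|² ≥ 1 − ε/2`:
an EVEN power close to `−1` forces `Re(X^m)` small, and `|Im X^m| ≤ m|Im X|`.  (For ODD `L` nothing of the sort holds: `(−1)^L = −1`.) [folklore] -/
theorem even_power_rigidity (X : SU2) (m : ℕ) {ε : ℝ}
    (h : frobNorm (((negOne : SU2) : Matrix (Fin 2) (Fin 2) ℂ) - ((X ^ (m + m) : SU2) : Matrix (Fin 2) (Fin 2) ℂ)) ≤ ε) :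
    1 - ε / 2 ≤ (m : ℝ) ^ 2 * ∑ i, vecPart X i ^ 2 := by
  have hε : 0 ≤ ε := (frobNorm_nonneg _).trans h
  obtain ⟨hNr, hN0, hN1, hN2⟩ := parts_negOne
  have hsq : 2 * ((scalarPart negOne - scalarPart (X ^ m * X ^ m)) ^ 2 + ∑ t, (vecPart negOne t - vecPart (X ^ m * X ^ m) t) ^ 2) ≤ ε ^ 2 := by
    rw [← frobNorm_sub_sq_eq, ← pow_add]; exact pow_le_pow_left₀ (frobNorm_nonneg _) h 2
  rw [scalarPart_mul_self, hNr] at hsq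
  have hsum0 : 0 ≤ ∑ t, (vecPart negOne t - vecPart (X ^ m * X ^ m) t) ^ 2 := Finset.sum_nonneg fun _ _ => sq_nonneg _
  have hid : (-1 - (2 * scalarPart (X ^ m) ^ 2 - 1)) ^ 2 = (2 * scalarPart (X ^ m) ^ 2) ^ 2 := by ring
  have h1 : (2 * scalarPart (X ^ m) ^ 2) ^ 2 ≤ ε ^ 2 := by nlinarith
  have h2 : 2 * scalarPart (X ^ m) ^ 2 ≤ ε := (pow_le_pow_iff_left₀ (by positivity) hε two_ne_zero).1 h1
  have h3 : ∑ i, vecPart (X ^ m) i ^ 2 = 1 - scalarPart (X ^ m) ^ 2 := sum_vecPart_sq (X ^ m)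
  have h4 := sum_vecPart_pow_sq_le X m
  linarith

/-- **Almost-commutation.**  `‖1 − X N X⁻¹ N⁻¹‖_F ≤ η ⇒ |Im X × Im N|² ≤ η²/8` (`‖Q − 1‖_F² = 4(1 − Re Q)` and `1 − Re[X,N] = 2|Im X × Im N|²`).
[cite: Luscher1983, §2] -/
theorem cross_sq_le_of_comm_near_one {X N : SU2} {η : ℝ}
    (h : frobNorm (1 - ((X * N * X⁻¹ * N⁻¹ : SU2) : Matrix (Fin 2) (Fin 2) ℂ)) ≤ η) :
    (vecPart X ⨯₃ vecPart N) ⬝ᵥ (vecPart X ⨯₃ vecPart N) ≤ η ^ 2 / 8 := by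
  rw [frobNorm_sub_comm] at h
  have h2 : frobNorm (((X * N * X⁻¹ * N⁻¹ : SU2) : Matrix (Fin 2) (Fin 2) ℂ) - 1) ^ 2 ≤ η ^ 2 := pow_le_pow_left₀ (frobNorm_nonneg _) h 2
  rw [frobNorm_sub_one_sq_eq_scalarPart, scalarPart_comm_eq] at h2
  linarith

/-- `|Im X × Im N|²` in coordinates (Lagrange's identity). [folklore] -/
theorem cross_dot_self_eq (X N : SU2) : (vecPart X ⨯₃ vecPart N) ⬝ᵥ (vecPart X ⨯₃ vecPart N) =
    (vecPart X 0 ^ 2 + vecPart X 1 ^ 2 + vecPart X 2 ^ 2) * (vecPart N 0 ^ 2 + vecPart N 1 ^ 2 + vecPart N 2 ^ 2) -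
      (vecPart X 0 * vecPart N 0 + vecPart X 1 * vecPart N 1 + vecPart X 2 * vecPart N 2) ^ 2 := by
  rw [cross_apply]
  simp [dotProduct, Fin.sum_univ_three]
  ring

end Quat

end Summit.QuantumFields.YangMills.Theorems.TwistedTraceScaling.Negative.R9

end
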